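import Mathlib.Algebra.Group.Subgroup.Finite
import Mathlib.GroupTheory.Commutator.Basic
import Mathlib.GroupTheory.Subgroup.Simple
import HarnessLib

/-!
# Normal subgroups of a finite product of non-abelian simple groups

Topic `GroupTheory/SpecificGroups`; theorems only (no definitions, no named facts); Mathlib only.
The group-theoretic sentence in the proof of Lemma 7.1.6 (3) of P. B. Allen, F. Calegari,
A. Caraiani, T. Gee, D. Helm, B. V. Le Hung, J. Newton, P. Scholze, R. Taylor, J. A. Thorne,
*Potential automorphy over CM fields*, Ann. of Math. (2) 197 (2023) [AllenCalegariCaraianiGeeEtAl2023]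
(held text `lit:arxiv-1812.09999`, p. 99, Lemma 135 = Lemma 7.1.6 of the Annals version):

> "the only normal subgroups of `PSL₂(k)^n` are `PSL₂(k)^I` for `I ⊂ {1, ..., n}`, as can be seen
> by induction on `n`, and so any automorphism of `PSL₂(k)^n` permutes the `n` factors of this
> product."

proved for an arbitrary finite product `Π i, S i` of non-abelian simple groups `S i`:

* `center_eq_bot_of_not_isMulCommutative` — a non-abelian simple group has trivial centre;
* `eq_pi_compl_bot_of_normal` / `exists_eq_pi_of_normal` — a normal subgroup `N` of `Π i, S i`
  is the sub-product `Π_{i ∈ I} S i` (the functions trivial off `I`), with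
  `I = {i | the i-th factor lies in N}`;
* `mulSingle_range_eq_pi`, `mulSingle_range_normal`, `mulSingle_range_le_pi_iff`,
  `exists_map_mulSingle_range_eq_pi`, `exists_map_mulSingle_range_eq` — consequently an
  automorphism of `Π i, S i` carries each factor `ι_i(S i)` onto a factor `ι_j(S j)`.

Proof (instead of the printed induction): for `f ∈ N` and a factor `i` not contained in `N`,
the pull-back of `N` to `S i` is a proper normal subgroup, hence trivial; it contains every
commutator `⁅s, f i⁆` (as `⁅ι_i(s), f⁆ = ι_i(⁅s, f i⁆) ∈ N`), so `f i` is central, i.e. `f i = 1`.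
Conversely a function supported on factors contained in `N` is a finite product of elements of
`N`. Non-commutativity is needed (`ℤ/p × ℤ/p` has diagonal normal subgroups).

## References
* [AllenCalegariCaraianiGeeEtAl2023] P. B. Allen et al., *Potential automorphy over CM fields*,
  Ann. of Math. (2) 197 (2023), 897–1113, doi:10.4007/annals.2023.197.3.2, §7.1, proof of
  Lemma 7.1.6 (3) (held text p. 99).
-/

open scoped commutatorElement

namespace Literature.GroupTheory.SpecificGroups

/-- A non-abelian simple group has trivial centre (the centre is normal, and it is not
everything). [folklore] -/
theorem center_eq_bot_of_not_isMulCommutative {G : Type*} [Group G] [IsSimpleGroup G]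
    (hG : ¬ IsMulCommutative G) : Subgroup.center G = ⊥ := by
  rcases (inferInstance : (Subgroup.center G).Normal).eq_bot_or_eq_top with h | h
  · exact h
  · exact absurd ((commutator_eq_bot_iff G).mp ((commutator_eq_bot_iff_center_eq_top G).mpr h)) hG

variable {ι : Type*} {S : ι → Type*} [∀ i, Group (S i)]

/-- Commutator with an element of the `i`-th factor: `⁅ι_i(s), f⁆ = ι_i(⁅s, f i⁆)`. [folklore] -/
theorem commutatorElement_mulSingle_left [DecidableEq ι] (i : ι) (s : S i) (f : ∀ i, S i) :
    ⁅Pi.mulSingle i s, f⁆ = Pi.mulSingle i ⁅s, f i⁆ := by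
  ext j
  simp only [commutatorElement_def, Pi.mul_apply, Pi.inv_apply]
  by_cases hj : j = i
  · subst hj
    simp
  · simp [Pi.mulSingle_eq_of_ne hj]

/-- **Normal subgroups of a finite product of non-abelian simple groups are sub-products**
(ACC⁺ 2023, proof of Lemma 7.1.6 (3): "the only normal subgroups of `PSL₂(k)^n` are `PSL₂(k)^I`
for `I ⊂ {1, …, n}`"). Precisely, with `I = {i | ι_i(S i) ≤ N}` the set of factors contained in
`N`, a normal subgroup `N ⊴ Π i, S i` consists exactly of the functions trivial outside `I`.
[cite: AllenCalegariCaraianiGeeEtAl2023, §7.1, proof of Lemma 7.1.6 (3)] -/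
theorem eq_pi_compl_bot_of_normal [Finite ι] [DecidableEq ι] [∀ i, IsSimpleGroup (S i)]
    (hS : ∀ i, ¬ IsMulCommutative (S i)) (N : Subgroup (∀ i, S i)) [hN : N.Normal] :
    N = Subgroup.pi {i | (MonoidHom.mulSingle S i).range ≤ N}ᶜ fun i => (⊥ : Subgroup (S i)) := by
  refine le_antisymm ?_ ?_
  · intro f hf
    rw [Subgroup.mem_pi]
    intro i hi
    rw [Subgroup.mem_bot]
    -- the pull-back of `N` to the factor `S i` is normal, hence trivial or everything
    rcases (inferInstance : (N.comap (MonoidHom.mulSingle S i)).Normal).eq_bot_or_eq_top with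
      h | h
    · -- trivial: every `⁅s, f i⁆` lies in it, so `f i` is central, hence `1`
      have hcomm : ∀ s : S i, ⁅s, f i⁆ = 1 := by
        intro s
        have hmem : ⁅Pi.mulSingle i s, f⁆ ∈ N := by
          rw [commutatorElement_def]
          exact N.mul_mem (hN.conj_mem f hf _) (N.inv_mem hf)
        rw [commutatorElement_mulSingle_left] at hmem
        have hmem' : ⁅s, f i⁆ ∈ N.comap (MonoidHom.mulSingle S i) := hmem
        rwa [h, Subgroup.mem_bot] at hmem'
      have hcen : f i ∈ Subgroup.center (S i) :=
        Subgroup.mem_center_iff.mpr fun s => commutatorElement_eq_one_iff_mul_comm.mp (hcomm s)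
      rwa [center_eq_bot_of_not_isMulCommutative (hS i), Subgroup.mem_bot] at hcen
    · -- everything: the factor lies in `N`, contradicting `i ∉ I`
      refine absurd ?_ hi
      rintro _ ⟨s, rfl⟩
      exact (h ▸ Subgroup.mem_top s : s ∈ N.comap (MonoidHom.mulSingle S i))
  · intro f hf
    refine Subgroup.pi_mem_of_mulSingle_mem f fun i => ?_
    by_cases hi : (MonoidHom.mulSingle S i).range ≤ N
    · exact hi ⟨f i, rfl⟩
    · have hfi : f i = 1 := Subgroup.mem_bot.mp ((Subgroup.mem_pi _).mp hf i hi)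
      rw [hfi, Pi.mulSingle_one]
      exact N.one_mem

/-- **Normal subgroups of a finite product of non-abelian simple groups**, existential form: every
normal subgroup of `Π i, S i` is `Π_{i ∈ I} S i = {f | ∀ i ∉ I, f i = 1}` for some set `I` of
indices. [cite: AllenCalegariCaraianiGeeEtAl2023, §7.1, proof of Lemma 7.1.6 (3)] -/
theorem exists_eq_pi_of_normal [Finite ι] [∀ i, IsSimpleGroup (S i)]
    (hS : ∀ i, ¬ IsMulCommutative (S i)) (N : Subgroup (∀ i, S i)) [N.Normal] :
    ∃ I : Set ι, N = Subgroup.pi Iᶜ fun i => (⊥ : Subgroup (S i)) := by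
  classical
  exact ⟨_, eq_pi_compl_bot_of_normal hS N⟩

/-! ### Automorphisms permute the factors -/

/-- The `i`-th factor `ι_i(S i) ≤ Π i, S i` is the sub-product over `{i}`. [folklore] -/
theorem mulSingle_range_eq_pi [DecidableEq ι] (i : ι) :
    (MonoidHom.mulSingle S i).range = Subgroup.pi {i}ᶜ fun j => (⊥ : Subgroup (S j)) := by
  ext f
  constructor
  · rintro ⟨s, rfl⟩
    exact (Subgroup.mulSingle_mem_pi i s).mpr fun h => (h rfl).elim
  · intro hf
    refine ⟨f i, funext fun j => ?_⟩
    by_cases hj : j = i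
    · subst hj
      simp
    · rw [MonoidHom.mulSingle_apply, Pi.mulSingle_eq_of_ne hj]
      exact (Subgroup.mem_bot.mp ((Subgroup.mem_pi _).mp hf j hj)).symm

/-- The `i`-th factor is a normal subgroup of the product. [folklore] -/
theorem mulSingle_range_normal [DecidableEq ι] (i : ι) :
    ((MonoidHom.mulSingle S i).range).Normal := by
  refine ⟨?_⟩
  rintro _ ⟨s, rfl⟩ g
  refine ⟨g i * s * (g i)⁻¹, funext fun j => ?_⟩
  by_cases hj : j = i
  · subst hj
    simp
  · simp [Pi.mulSingle_eq_of_ne hj]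

/-- A factor with a non-trivial group lies in the sub-product over `J` iff its index is in `J`.
[folklore] -/
theorem mulSingle_range_le_pi_iff [DecidableEq ι] {i : ι} [Nontrivial (S i)] {J : Set ι} :
    (MonoidHom.mulSingle S i).range ≤ Subgroup.pi Jᶜ (fun j => (⊥ : Subgroup (S j))) ↔ i ∈ J := by
  constructor
  · intro h
    obtain ⟨s, hs⟩ := exists_ne (1 : S i)
    by_contra hi
    exact hs (Subgroup.mem_bot.mp ((Subgroup.mulSingle_mem_pi i s).mp (h ⟨s, rfl⟩) hi))
  · rintro hi _ ⟨s, rfl⟩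
    exact (Subgroup.mulSingle_mem_pi i s).mpr fun h => (h hi).elim

/-- The image of a factor under an automorphism of a finite product of non-abelian simple groups
is a sub-product over a non-empty set of indices. [folklore] -/
theorem exists_map_mulSingle_range_eq_pi [Finite ι] [DecidableEq ι] [∀ i, IsSimpleGroup (S i)]
    (hS : ∀ i, ¬ IsMulCommutative (S i)) (ψ : (∀ i, S i) ≃* (∀ i, S i)) (i : ι) :
    ∃ J : Set ι, J.Nonempty ∧
      ((MonoidHom.mulSingle S i).range).map (ψ : (∀ i, S i) →* ∀ i, S i) =
        Subgroup.pi Jᶜ fun j => (⊥ : Subgroup (S j)) := by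
  haveI := Subgroup.Normal.map (mulSingle_range_normal (S := S) i)
    (ψ : (∀ i, S i) →* ∀ i, S i) ψ.surjective
  obtain ⟨J, hJ⟩ := exists_eq_pi_of_normal hS
    (((MonoidHom.mulSingle S i).range).map (ψ : (∀ i, S i) →* ∀ i, S i))
  refine ⟨J, ?_, hJ⟩
  rw [Set.nonempty_iff_ne_empty]
  rintro rfl
  rw [Set.compl_empty, Subgroup.pi_bot, Subgroup.map_eq_bot_iff_of_injective _ ψ.injective] at hJ
  obtain ⟨s, hs⟩ := exists_ne (1 : S i)
  have hmem : Pi.mulSingle i s ∈ (MonoidHom.mulSingle S i).range := ⟨s, rfl⟩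
  rw [hJ, Subgroup.mem_bot, Pi.mulSingle_eq_one_iff] at hmem
  exact hs hmem

/-- **Automorphisms of a finite product of non-abelian simple groups permute the factors**
(ACC⁺ 2023, proof of Lemma 7.1.6 (3): "and so any automorphism of `PSL₂(k)^n` permutes the `n`
factors of this product"): for every automorphism `φ` and index `i` there is an index `j` with
`φ(ι_i(S i)) = ι_j(S j)`. [cite: AllenCalegariCaraianiGeeEtAl2023, §7.1, proof of Lemma 7.1.6 (3)] -/
theorem exists_map_mulSingle_range_eq [Finite ι] [DecidableEq ι] [∀ i, IsSimpleGroup (S i)]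
    (hS : ∀ i, ¬ IsMulCommutative (S i)) (φ : (∀ i, S i) ≃* (∀ i, S i)) (i : ι) :
    ∃ j, ((MonoidHom.mulSingle S i).range).map (φ : (∀ i, S i) →* ∀ i, S i) =
      (MonoidHom.mulSingle S j).range := by
  obtain ⟨J, ⟨j, hj⟩, hJ⟩ := exists_map_mulSingle_range_eq_pi hS φ i
  refine ⟨j, ?_⟩
  -- `ι_j(S j) ≤ φ(ι_i(S i))`
  have h1 : (MonoidHom.mulSingle S j).range ≤
      ((MonoidHom.mulSingle S i).range).map (φ : (∀ i, S i) →* ∀ i, S i) := by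
    rw [hJ]
    exact mulSingle_range_le_pi_iff.mpr hj
  -- `φ⁻¹(ι_j(S j))` is a sub-product over some non-empty `J' ⊆ {i}`, hence equals `ι_i(S i)`
  obtain ⟨J', ⟨j', hj'⟩, hJ'⟩ := exists_map_mulSingle_range_eq_pi hS φ.symm j
  have h2 : ((MonoidHom.mulSingle S j).range).map (φ.symm : (∀ i, S i) →* ∀ i, S i) ≤
      (MonoidHom.mulSingle S i).range := by
    refine (Subgroup.map_mono h1).trans ?_
    rw [Subgroup.map_map, MulEquiv.coe_monoidHom_symm_comp_coe_monoidHom, Subgroup.map_id]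
  have hJ'sub : J' ⊆ {i} := by
    intro j'' hj''
    have hle : (MonoidHom.mulSingle S j'').range ≤ (MonoidHom.mulSingle S i).range := by
      refine le_trans ?_ h2
      rw [hJ']
      exact mulSingle_range_le_pi_iff.mpr hj''
    rw [mulSingle_range_eq_pi i] at hle
    exact mulSingle_range_le_pi_iff.mp hle
  have hi : i ∈ J' := by
    obtain rfl : j' = i := hJ'sub hj'
    exact hj'
  have hJ'eq : J' = {i} := Set.Subset.antisymm hJ'sub (Set.singleton_subset_iff.mpr hi)
  have h3 : ((MonoidHom.mulSingle S j).range).map (φ.symm : (∀ i, S i) →* ∀ i, S i) =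
      (MonoidHom.mulSingle S i).range := by
    rw [hJ', hJ'eq, ← mulSingle_range_eq_pi]
  have h4 := congrArg (Subgroup.map (φ : (∀ i, S i) →* ∀ i, S i)) h3
  rw [Subgroup.map_map, MulEquiv.coe_monoidHom_comp_coe_monoidHom_symm, Subgroup.map_id] at h4
  exact h4.symm

end Literature.GroupTheory.SpecificGroups
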